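/-
Origin: expansion seat `planner-pub-hodgecm-pv01-g5-0`, handover pv01-g5 ; 2026-08-18T12:06:21Z (`HOME/pub-hodgecm-pv01-g5/lean/Pv01g5/EndStateMinimal.lean`, md5 2fdad1cc, 138 lines);
landed by the gen-8 packager in gate run 29 as `HodgeCM/PerL34/EndStateMinimal.lean` (verbatim).
-/
/-
Copyright: pub-hodgecm formalisation cell (harness21, 2026). New file (not vendored).
Origin: HOME/pub-hodgecm-pv01-g5/lean/Pv01g5/EndStateMinimal.lean — session planner-pub-hodgecm-pv01-g5-0 (unit
pub-hodgecm-pv01-g5, DAG-NODE PROVER #01, generation 5), seventh file.  WIP module `Pv01g5.EndStateMinimal`; intended final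
place `HodgeCM/PerL34/EndStateMinimal.lean` (module `HodgeCM.PerL34.EndStateMinimal`).  ADDITIVE LEAF: replaces nothing,
nothing imports it.  Imports are TREE names only, both landed in gate run 28: `HodgeCM.PerL34.EndStateHCCMNoN3` (qw8b-g6)
and `HodgeCM.PerL34.EndStateSignRecipe` (this seat) — NO import rewrite.
-/
import Summits.HodgeConjecture.HodgeCM.PerL34.EndStateHCCMNoN3
import Summits.HodgeConjecture.HodgeCM.PerL34.EndStateSignRecipe

/-!
# The MINIMAL end-to-end statement of record: `HC_CM` from `M` + twelve PerL-side binders + seven [QW8]-side facts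

Binder ledger of the cell's end-to-end theorems `… → U.HC_CM` (all gate-audited kernel theorems; "PerL side" = the binders
of `AssemblyRoutes.perL_of_openCharsWeilLeavesCRΔ`; "[QW8] side" = the descent facts of `Assembly.COR_CM_of_descentFacts*`):

* run 26, `HodgeCM.PerL34.hcCM_of_openCharsWeilLeavesCRΔ_descentFacts` (pv01-g5): `M` + 13 ∣ 8 (N1, N2, N3, N4, F4, F5,
  F7d, M40);
* run 27, `hcCM_of_openCharsWeilLeavesCRΔ_descentFacts₃` (qw8b-g5): `M` + 13 ∣ 7 (route (γ), with N3);
* run 28, `hcCM_of_openCharsWeilLeavesCRΔ_descentFactsB₄` (qw8b-g6): `M` + 13 ∣ 7 (route (δ): N1, N2, F4, F5, F-H0, F7d-B,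
  M40 — no N3, no N4);
* run 28, `EndStateSignRecipe.hcCM_of_openCharsWeilLeavesCRΔ_signRecipe_descentFacts` (pv01-g5): `M` + 12 over the
  re-signed model `T.withSignRecipe h` (h12b discharged) ∣ 8;
* THIS FILE, `HodgeCM.PerL34.hcCM_of_openCharsWeilLeavesCRΔ_signRecipe_descentFactsB₄`: `M` + 12 over `T.withSignRecipe h`
  ∣ 7 (route (δ)).

The two run-28 reductions act on disjoint binder lists (one on the PerL side, one on the [QW8] side), so they compose; this
file records the composite once, in three forms:

* `EndStateSignRecipe.endToEnd_signRecipeB₄ (M) (P : EndStatePrints4 T) (B : HeadlineBundle (T.withSignRecipe h) Pc)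
  (hN1 hN2 h4 h5 hu hb hd) : U.HC_CM ∧ U.PerL44 ∧ U.PerL ∧ U.PeriodThmF ∧ U.W_RK4` — every conclusion of record;
* `EndStateSignRecipe.hcCM_of_prints4_dictLeavesB₄ (M) (P) (hcov) (hD : DictLeaves (T.withSignRecipe h) Pc) (hN1 … hd) :
  U.HC_CM` — leaves form: `M` + the four facts (three P-anchored print facts N07, N09a, N09b + the class-M model fact M38)
  + definitional `coverTheta` + the seven dictionary leaves of the re-signed model + the seven route-(δ) facts;
* `HodgeCM.PerL34.hcCM_of_openCharsWeilLeavesCRΔ_signRecipe_descentFactsB₄` — binders explicit (audited-list form): `M`;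
  the convention bit `h : Bool` (a parameter, not a hypothesis); the twelve PerL-side binders over `T.withSignRecipe h` in
  the order and with the types of `perL_of_openCharsWeilLeavesCRΔ`, `h12b` omitted (N09a/N09b stated for `T`: literally the
  same propositions, `N12bSignRecipe.N09a_withSignRecipe_iff` / `N09b_withSignRecipe_iff` are `Iff.rfl`); the seven
  [QW8]-side facts of route (δ).  `M` + 12 + 7.

HONEST READING (as in both parents, said once more): nothing here makes any binder smaller.  h12b is discharged only because
the model is RE-SIGNED to print's recipe (prl1-g5 `N12bSignRecipe`, run 27), which changes exactly the guard `GoodCtx` of the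
open binders (`EndStateSignRecipe.goodCtx_withSignRecipe_iff`); N3 and N4 leave the [QW8] list only on route (δ), whose
inputs F-H0 `Fact_unitH0` and F7d-B `Fact_gysinDescentB` do their work (qw8b-g6 `StubTree/Qw8NoN3`, qw8b-g5
`COR_CM_of_descentFactsB₃`).  The PerL side remains: `M` + three P-anchored print facts + the class-M model fact M38 + seven
dictionary leaves (mod `M`) + definitional `coverTheta` (`EndStateSignRecipe.endState_withSignRecipe_iff`).  Nothing cited,
nothing posited; Mathlib + the package only.
-/

set_option autoImplicit false

noncomputable section

open HodgeCM.Prior.Perl34File HodgeCM.Prior.Perl34File.Perl34 HodgeCM.PerL34.ArchC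

namespace HodgeCM

namespace PerL34

namespace EndStateSignRecipe

open Universe Universe.ThetaModel AssemblyRoutes EndStateShadow EndStateCensus EndStateLinks CharSpansFinal

variable {U : Universe} {T : U.ThetaModel} (h : Bool)
variable {Pc : ∀ {L : CMField} {ι₁ : L →+* ℂ} (V : HermSpace3 L ι₁) (c : SeesawCtx L),
  C4a.PointedCore (T.core V c)}

/-- **Every conclusion of record, minimal inputs on both sides**: from `M`, the four facts (3 P + M38) of `T`, the
headline bundle of the re-signed model `T.withSignRecipe h`, and the seven [QW8]-side facts of route (δ) — N1
`Fact_cupExterior`, N2 `Fact_cup_hodge`, F4 `Fact_cupAlg`, F5 `Fact_cupAssoc`, F-H0 `Fact_unitH0`, F7d-B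
`Fact_gysinDescentB`, M40 `Fact_dimProd` (no N3, no N4, no h12b): `HC_CM`, `PerL44`, `PerL`, the period theorem face F,
`W_RK4`.  (= `EndStateHCCM.endToEndB₄` at the end state supplied by `endState_withSignRecipe_iff_headlineBundle`.) -/
theorem endToEnd_signRecipeB₄ (M : U.ModelAxioms) (P : EndStatePrints4 T)
    (B : HeadlineBundle (T.withSignRecipe h) Pc)
    (hN1 : U.Fact_cupExterior) (hN2 : U.Fact_cup_hodge) (h4 : U.Fact_cupAlg) (h5 : U.Fact_cupAssoc)
    (hu : U.Fact_unitH0) (hb : U.Fact_gysinDescentB) (hd : U.Fact_dimProd) :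
    U.HC_CM ∧ U.PerL44 ∧ U.PerL ∧ U.PeriodThmF ∧ U.W_RK4 :=
  EndStateHCCM.endToEndB₄ M ((endState_withSignRecipe_iff_headlineBundle h).2 ⟨P, B⟩) hN1 hN2 h4 h5 hu hb hd

/-- **`HC_CM`, leaves form, minimal inputs on both sides**: `M` + the four facts (3 P + M38) + definitional `coverTheta`
+ the seven dictionary leaves of the re-signed model + the seven route-(δ) facts.
(= `EndStateHCCM.hcCM_of_endState_descentFactsB₄` at `endState_withSignRecipe_of_dictLeaves`.) -/
theorem hcCM_of_prints4_dictLeavesB₄ (M : U.ModelAxioms) (P : EndStatePrints4 T) (hcov : T.Fact_coverTheta)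
    (hD : DictLeaves (T.withSignRecipe h) Pc)
    (hN1 : U.Fact_cupExterior) (hN2 : U.Fact_cup_hodge) (h4 : U.Fact_cupAlg) (h5 : U.Fact_cupAssoc)
    (hu : U.Fact_unitH0) (hb : U.Fact_gysinDescentB) (hd : U.Fact_dimProd) : U.HC_CM :=
  EndStateHCCM.hcCM_of_endState_descentFactsB₄ M (endState_withSignRecipe_of_dictLeaves h M P hcov hD)
    hN1 hN2 h4 h5 hu hb hd

/-- The composite does not depend on which run-28 reduction is applied first: the (E8)-list statement of
`EndStateSignRecipe` specialises to this one by forgetting `hN3`, `hN4` only through route (δ)'s own inputs — recorded as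
the trivial implication from the seven-fact form to the conclusion of the eight-fact form (same end state). -/
theorem endToEnd_signRecipe_of_B₄ (M : U.ModelAxioms) (P : EndStatePrints4 T)
    (B : HeadlineBundle (T.withSignRecipe h) Pc)
    (hN1 : U.Fact_cupExterior) (hN2 : U.Fact_cup_hodge) (h4 : U.Fact_cupAlg) (h5 : U.Fact_cupAssoc)
    (hu : U.Fact_unitH0) (hb : U.Fact_gysinDescentB) (hd : U.Fact_dimProd) :
    U.HC_CM ∧ U.PerL :=
  have e := endToEnd_signRecipeB₄ h M P B hN1 hN2 h4 h5 hu hb hd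
  ⟨e.1, e.2.2.1⟩

end EndStateSignRecipe

/-- **`HC_CM` END TO END, MINIMAL BINDER LIST OF RECORD — `M` + 12 + 7** (audited-list form): the model axioms `M`; the
convention bit `h`; the twelve PerL-side binders over the re-signed model `T.withSignRecipe h` in the order and with the
types of `AssemblyRoutes.perL_of_openCharsWeilLeavesCRΔ`, `h12b` OMITTED (it is the theorem
`N12b_signRecipe_withSignRecipe T h`); the seven [QW8]-side facts of route (δ) N1, N2, F4, F5, F-H0, F7d-B, M40 (no N3,
no N4).  Conclusion: `U.HC_CM`.  Compare `hcCM_of_openCharsWeilLeavesCRΔ_descentFacts` (run 26: `M` + 13 + 8),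
`hcCM_of_openCharsWeilLeavesCRΔ_descentFactsB₄` (run 28: `M` + 13 + 7) and
`EndStateSignRecipe.hcCM_of_openCharsWeilLeavesCRΔ_signRecipe_descentFacts` (run 28: `M` + 12 + 8). -/
theorem hcCM_of_openCharsWeilLeavesCRΔ_signRecipe_descentFactsB₄ {U : Universe} (M : U.ModelAxioms)
    (T : U.ThetaModel) (h : Bool)
    (h07 : N07_hodgeRiemann20 U) (h09a : N09a_embCover T) (h09b : N09b_innerEmb T)
    (hM38 : U.Fact_cmInflation) (hAlb : (T.withSignRecipe h).Fact_thetaAlbanese)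
    (hbr : ∀ {L : CMField} {ι₁ : L →+* ℂ} (V : HermSpace3 L ι₁) (c : SeesawCtx L), (T.withSignRecipe h).GoodCtx ι₁ c →
      Nonempty (SeesawDictionary.SeesawBridge (T.withSignRecipe h) V c ((T.withSignRecipe h).t12 V c) 0 1))
    (hQ : ∀ {L : CMField} {ι₁ : L →+* ℂ} (V : HermSpace3 L ι₁) (c : SeesawCtx L), (T.withSignRecipe h).GoodCtx ι₁ c →
      Nonempty (QautDictionary.QautBridge (T.withSignRecipe h) V c ((T.withSignRecipe h).t34 V c) 2 3))
    (Pc : ∀ {L : CMField} {ι₁ : L →+* ℂ} (V : HermSpace3 L ι₁) (c : SeesawCtx L),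
      C4a.PointedCore ((T.withSignRecipe h).core V c))
    (A12 : ∀ {L : CMField} {ι₁ : L →+* ℂ} (V : HermSpace3 L ι₁) (c : SeesawCtx L),
      (T.withSignRecipe h).GoodCtx ι₁ c →
        Nonempty (ArchCDatum ((T.withSignRecipe h).core V c) ((T.withSignRecipe h).t12 V c) (Pc V c)))
    (A34 : ∀ {L : CMField} {ι₁ : L →+* ℂ} (V : HermSpace3 L ι₁) (c : SeesawCtx L),
      (T.withSignRecipe h).GoodCtx ι₁ c →
        Nonempty (ArchCDatum ((T.withSignRecipe h).core V c) ((T.withSignRecipe h).t34 V c) (Pc V c)))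
    (hch : (T.withSignRecipe h).Open_chars) (hW : CharSpansFinal.WeilStepsInputCRΔ (T.withSignRecipe h))
    (hN1 : U.Fact_cupExterior) (hN2 : U.Fact_cup_hodge) (h4 : U.Fact_cupAlg) (h5 : U.Fact_cupAssoc)
    (hu : U.Fact_unitH0) (hb : U.Fact_gysinDescentB) (hd : U.Fact_dimProd) : U.HC_CM :=
  HodgeCM.PerL34.hcCM_of_openCharsWeilLeavesCRΔ_descentFactsB₄ M (T.withSignRecipe h) h07
    ((N09a_withSignRecipe_iff T h).2 h09a) ((N09b_withSignRecipe_iff T h).2 h09b) hM38 hAlb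
    (N12b_signRecipe_withSignRecipe T h) hbr hQ Pc A12 A34 hch hW hN1 hN2 h4 h5 hu hb hd

end PerL34

end HodgeCM

end
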